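import Mathlib
import Literature.Computability.AlgebraicComplexity.GlynnMultilinearSigmaPiSigma
import Summits.ValiantsHypothesis.ValiantsHypothesis.Theorems.RigidityForcesSymmetryPairTiedTorusBoundDefs
import Summits.ValiantsHypothesis.ValiantsHypothesis.Theorems.RigidityForcesSymmetryRankRigidMinimalReprBlockDefs

/-!
# Stub `stub_levelBound` of crux `RankRigidMinimalRepr` (stmt-ValiantsHypothesis-18034), line `PairTiedTorusBound`
# — part 1: blocks of typed products

Route `ValiantsHypothesis/RigidityForcesSymmetry`, crux `RankRigidMinimalRepr` (stmt-ValiantsHypothesis-18034), forward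
rung `PairTiedTorusBound` (crux workfile `Cruxes/RankRigidMinimalRepr/Lines/PairTiedTorusBound.lean`, planner-fwd-rung
2026-08-17), registered stub `stub_levelBound`:

  `∀ m ≥ 3, ∀ s w, 1 ≤ s → s + 1 ≤ m → TiedLevelDecomposable m 1 s w → m.choose s ≤ w`

— with ONE tied pair of columns (`e₀ = e₁`), every level-`s` typed decomposition `perm_m = Σ_{t<w} P_t Q_t` (tree
`Theorems.RigidityForcesSymmetryPairTiedTorusBound.TiedLevelDecomposable`, verbatim the workfile's) still uses
`w ≥ C(m, s)` products, although a product of tied type may serve both completions `σ(I) = C ∪ {0}` and `C ∪ {1}`.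
The stub itself is landed in part 2 (`…StubLevelBound.lean`); this file proves the block lemmas it rests on.

**The `2 × 2`-block argument** (vocabulary `graphMonomialOn`, `tau` of `…RankRigidMinimalReprBlockDefs.lean`).  For a
permutation `σ` put `p = σ⁻¹ 0`, `q = σ⁻¹ 1` and consider the four one-variable-per-row monomials of the self-maps
`σ[p ↦ a, q ↦ b]`, `a, b ∈ {0, 1}` — the BLOCK of `σ`.  The permanent's coefficients on the block are `[[0, 1], [1, 0]]`.
1. (`coeff_graphMonomial_mul_of_rowTyped`) If `P` is row-typed by `I` (degree `1` in each row of `I`, `0` elsewhere)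
   and `Q` by `Iᶜ`, then `coeff_{x^τ} (P Q) = coeff_{x^{τ|I}} P · coeff_{x^{τ|Iᶜ}} Q` for every one-variable-per-row
   monomial `x^τ` — unique factorisation.
2. (`block_det_eq_of_separates`) Hence if `I` separates `p` from `q`, the block of `P Q` at `σ` is an outer product
   `u_a v_b`: its determinant vanishes.
3. (`symm_mem_iff_of_mem_support`, `ct_eq_of_mem_support`) If the row part over `I` of a block monomial lies in the
   support of a polynomial tied-typed by `(I, c, ct)`, then `σ⁻¹ j ∈ I ↔ c j = 1` for untied `j`, and
   `ct = [p ∈ I] + [q ∈ I]`.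
Part 2 turns these into a double count: each `σ` needs a product of exact type (`ct ∈ {0, 2}`) or two of tied type
touching its block, and a product touches at most `2 · s!(m-s)!` (weighted) permutations.

HONEST FRAMING: lemmas toward ONE stub of a forward rung (Grenet's `2^m - 1` under a codimension-one subtorus of
the two-sided torus); the rung also needs the dictionary stub `stub_levelDecomp`; nothing here bears on `VP ≠ VNP`.
Nearest literature: Nisan 1991 (partial-derivative / flattening rank for ABP width) and Landsberg–Ressayre 2017 §6
(equivariant determinantal complexity of the permanent); the block count itself is route mathematics.
-/

set_option autoImplicit false

-- the mandated summit-side namespace repeats a component by design (single-problem summit)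
set_option linter.dupNamespace false

open MvPolynomial Finset
open Literature.Computability.AlgebraicComplexity
open Summit.ValiantsHypothesis.ValiantsHypothesis.Theorems.RigidityForcesSymmetryPairTiedTorusBound

namespace Summit.ValiantsHypothesis.ValiantsHypothesis.Theorems.RigidityForcesSymmetryRankRigidMinimalRepr

noncomputable section

/-! ### §1 Unique factorisation of row-typed products -/

variable {m : ℕ}

/-- **Unique factorisation of row-typed products.**  If every monomial of `P` has degree `1` in each row of `I`
and `0` elsewhere, and likewise for `Q` and `Iᶜ`, then the coefficient in `P · Q` of a one-variable-per-row
monomial `∏_i X_{i, τ i}` is the product of the coefficients of its row parts: the only splitting `e + f` of the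
exponent with `e ∈ supp P`, `f ∈ supp Q` is `e =` (rows in `I`), `f =` (rows off `I`). -/
theorem coeff_graphMonomial_mul_of_rowTyped {I : Finset (Fin m)} {P Q : MvPolynomial (Fin m × Fin m) ℂ}
    (hP : ∀ d ∈ P.support, ∀ i : Fin m, (∑ j : Fin m, d (i, j)) = if i ∈ I then 1 else 0)
    (hQ : ∀ d ∈ Q.support, ∀ i : Fin m, (∑ j : Fin m, d (i, j)) = if i ∈ Iᶜ then 1 else 0)
    (τ : Fin m → Fin m) :
    coeff (graphMonomial τ) (P * Q) =
      coeff (graphMonomialOn I τ) P * coeff (graphMonomialOn Iᶜ τ) Q := by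
  classical
  rw [coeff_mul, Finset.sum_eq_single (graphMonomialOn I τ, graphMonomialOn Iᶜ τ)]
  · rintro ⟨e, f⟩ hef hne
    by_contra h
    have he : e ∈ P.support := mem_support_iff.2 (left_ne_zero_of_mul h)
    have hf : f ∈ Q.support := mem_support_iff.2 (right_ne_zero_of_mul h)
    have hsum : ∀ i j, e (i, j) + f (i, j) = if τ i = j then 1 else 0 := fun i j => by
      have := DFunLike.congr_fun (Finset.HasAntidiagonal.mem_antidiagonal.1 hef) (i, j)
      rwa [Finsupp.add_apply, graphMonomial_apply] at this
    have he0 : ∀ i, i ∉ I → ∀ j, e (i, j) = 0 := fun i hi j => by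
      have h0 := hP e he i
      rw [if_neg hi] at h0
      exact Finset.sum_eq_zero_iff.1 h0 j (Finset.mem_univ _)
    have hf0 : ∀ i, i ∈ I → ∀ j, f (i, j) = 0 := fun i hi j => by
      have h0 := hQ f hf i
      rw [if_neg (fun h' => Finset.mem_compl.1 h' hi)] at h0
      exact Finset.sum_eq_zero_iff.1 h0 j (Finset.mem_univ _)
    apply hne
    refine Prod.ext ?_ ?_
    · ext ⟨i, j⟩
      rw [graphMonomialOn_apply]
      by_cases hi : i ∈ I
      · have := hsum i j
        rw [hf0 i hi j, add_zero] at this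
        rw [this]
        by_cases hij : τ i = j <;> simp [hi, hij]
      · rw [he0 i hi j]
        simp [hi]
    · ext ⟨i, j⟩
      rw [graphMonomialOn_apply]
      by_cases hi : i ∈ I
      · rw [hf0 i hi j]
        simp [hi]
      · have := hsum i j
        rw [he0 i hi j, zero_add] at this
        rw [this]
        by_cases hij : τ i = j <;> simp [hi, hij]
  · intro h
    exact absurd (Finset.HasAntidiagonal.mem_antidiagonal.2 (graphMonomialOn_add_compl I τ)) h

/-- Unique factorisation for a pair of TIED-TYPED polynomials on complementary rows (the first clause of
`IsTiedTyped` is row-typing). -/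
theorem coeff_graphMonomial_mul_of_isTiedTyped {k : ℕ} {I : Finset (Fin m)} {c c' : Fin m → ℕ} {ct ct' : ℕ}
    {P Q : MvPolynomial (Fin m × Fin m) ℂ} (hP : IsTiedTyped m k I c ct P) (hQ : IsTiedTyped m k Iᶜ c' ct' Q)
    (τ : Fin m → Fin m) :
    coeff (graphMonomial τ) (P * Q) =
      coeff (graphMonomialOn I τ) P * coeff (graphMonomialOn Iᶜ τ) Q :=
  coeff_graphMonomial_mul_of_rowTyped (fun d hd => (hP d hd).1) (fun d hd => (hQ d hd).1) τ

/-! ### §2 Rank one on the block of a separated pair -/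

variable {n : ℕ}

/-- **Rank one on the block.**  If `P`, `Q` are tied-typed on complementary rows `I`, `Iᶜ` and `I` SEPARATES
`p = σ⁻¹ 0` from `q = σ⁻¹ 1`, then the `2 × 2` block `(a, b) ↦ coeff_{σ[p ↦ a, q ↦ b]} (P · Q)` is an outer
product `u_a v_b` (the row part over `I` does not see `b`, the one over `Iᶜ` does not see `a`, by unique
factorisation), so its determinant vanishes. -/
theorem block_det_eq_of_separates {k : ℕ} {I : Finset (Fin (n + 2))} {c c' : Fin (n + 2) → ℕ} {ct ct' : ℕ}
    {P Q : MvPolynomial (Fin (n + 2) × Fin (n + 2)) ℂ} (hP : IsTiedTyped (n + 2) k I c ct P)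
    (hQ : IsTiedTyped (n + 2) k Iᶜ c' ct' Q) (σ : Equiv.Perm (Fin (n + 2)))
    (hsep : (σ.symm 0 ∈ I ∧ σ.symm 1 ∉ I) ∨ (σ.symm 0 ∉ I ∧ σ.symm 1 ∈ I)) :
    coeff (graphMonomial (tau σ 0 0)) (P * Q) * coeff (graphMonomial (tau σ 1 1)) (P * Q) =
      coeff (graphMonomial (tau σ 0 1)) (P * Q) * coeff (graphMonomial (tau σ 1 0)) (P * Q) := by
  simp only [coeff_graphMonomial_mul_of_isTiedTyped hP hQ]
  rcases hsep with ⟨hp, hq⟩ | ⟨hp, hq⟩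
  · -- the row part over `I` does not depend on `b`, the one over `Iᶜ` not on `a`
    have hI : ∀ a b b' : Fin (n + 2), graphMonomialOn I (tau σ a b) = graphMonomialOn I (tau σ a b') :=
      fun a b b' => graphMonomialOn_congr fun i hi => by
        have h1 : i ≠ σ.symm 1 := fun h => hq (h ▸ hi)
        simp [tau, h1]
    have hIc : ∀ a a' b : Fin (n + 2), graphMonomialOn Iᶜ (tau σ a b) = graphMonomialOn Iᶜ (tau σ a' b) :=
      fun a a' b => graphMonomialOn_congr fun i hi => by
        have h0 : i ≠ σ.symm 0 := fun h => (Finset.mem_compl.1 hi) (h ▸ hp)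
        simp [tau, h0]
    rw [hI 0 1 0, hI 1 0 1, hIc 0 1 1, hIc 1 0 0]
    ring
  · -- the row part over `I` does not depend on `a`, the one over `Iᶜ` not on `b`
    have hI : ∀ a a' b : Fin (n + 2), graphMonomialOn I (tau σ a b) = graphMonomialOn I (tau σ a' b) :=
      fun a a' b => graphMonomialOn_congr fun i hi => by
        have h0 : i ≠ σ.symm 0 := fun h => hp (h ▸ hi)
        simp [tau, h0]
    have hIc : ∀ a b b' : Fin (n + 2), graphMonomialOn Iᶜ (tau σ a b) = graphMonomialOn Iᶜ (tau σ a b') :=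
      fun a b b' => graphMonomialOn_congr fun i hi => by
        have h1 : i ≠ σ.symm 1 := fun h => (Finset.mem_compl.1 hi) (h ▸ hq)
        simp [tau, h1]
    rw [hI 0 1 1, hI 1 0 0, hIc 0 1 0, hIc 1 0 1]
    ring

/-! ### §3 What a typed polynomial sees on a block (tie `k = 1`) -/

/-- **Untied columns seen by a typed polynomial.**  If the row part over `I` of a block monomial of `σ` lies in the
support of a polynomial typed by `(I, c, ct)`, then for every untied column `j`: `σ⁻¹ j ∈ I ↔ c j = 1`. -/
theorem symm_mem_iff_of_mem_support {I : Finset (Fin (n + 2))} {c : Fin (n + 2) → ℕ} {ct : ℕ}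
    {P : MvPolynomial (Fin (n + 2) × Fin (n + 2)) ℂ} (hP : IsTiedTyped (n + 2) 1 I c ct P)
    (σ : Equiv.Perm (Fin (n + 2))) {a b : Fin (n + 2)} (ha : a.val ≤ 1) (hb : b.val ≤ 1)
    (hmem : graphMonomialOn I (tau σ a b) ∈ P.support) {j : Fin (n + 2)} (hj : 1 < j.val) :
    σ.symm j ∈ I ↔ c j = 1 := by
  classical
  have h2 := (hP _ hmem).2.1 j hj
  rw [sum_graphMonomialOn_col] at h2
  have hfilter : (I.filter fun i => tau σ a b i = j) = I.filter fun i => i = σ.symm j := by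
    refine Finset.filter_congr fun i _ => ?_
    rw [tau_eq_iff_of_untied σ ha hb hj, Equiv.eq_symm_apply]
  rw [hfilter, Finset.filter_eq'] at h2
  by_cases h : σ.symm j ∈ I
  · rw [if_pos h, Finset.card_singleton] at h2
    exact ⟨fun _ => h2.symm, fun _ => h⟩
  · rw [if_neg h, Finset.card_empty] at h2
    refine ⟨fun h' => absurd h' h, fun h' => ?_⟩
    omega

/-- **Tied total seen by a typed polynomial.**  In the same situation the tied total `ct` equals
`[p ∈ I] + [q ∈ I]`. -/
theorem ct_eq_of_mem_support {I : Finset (Fin (n + 2))} {c : Fin (n + 2) → ℕ} {ct : ℕ}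
    {P : MvPolynomial (Fin (n + 2) × Fin (n + 2)) ℂ} (hP : IsTiedTyped (n + 2) 1 I c ct P)
    (σ : Equiv.Perm (Fin (n + 2))) {a b : Fin (n + 2)} (ha : a.val ≤ 1) (hb : b.val ≤ 1)
    (hmem : graphMonomialOn I (tau σ a b) ∈ P.support) :
    ct = (if σ.symm 0 ∈ I then 1 else 0) + (if σ.symm 1 ∈ I then 1 else 0) := by
  classical
  have h3 := (hP _ hmem).2.2
  simp_rw [sum_graphMonomialOn_col] at h3
  rw [Finset.sum_card_fiberwise_eq_card_filter] at h3
  have hfilter : (I.filter fun i => tau σ a b i ∈ Finset.univ.filter (fun j : Fin (n + 2) => j.val ≤ 1)) =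
      I.filter fun i => i = σ.symm 0 ∨ i = σ.symm 1 := by
    refine Finset.filter_congr fun i _ => ?_
    rw [Finset.mem_filter, tau_val_le_one_iff σ ha hb]
    simp
  rw [hfilter, Finset.filter_or, Finset.filter_eq', Finset.filter_eq'] at h3
  rw [← h3]
  by_cases hp : σ.symm 0 ∈ I <;> by_cases hq : σ.symm 1 ∈ I <;>
    simp [hp, hq, symm_zero_ne_symm_one σ]

end

end Summit.ValiantsHypothesis.ValiantsHypothesis.Theorems.RigidityForcesSymmetryRankRigidMinimalRepr
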